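import Mathlib
import HarnessLib
import HarnessLib.Audit
import Summits.CriticalPhenomena.Statement
import Literature.Probability.RandomPlanarGeometry.HexSAW
import Literature.Probability.RandomPlanarGeometry.HexSAWBridges
import Literature.Probability.RandomPlanarGeometry.HexSAWLowerBound
import Literature.Probability.RandomPlanarGeometry.SLEUniquenessInLaw
import Literature.Probability.RandomPlanarGeometry.EdgeFugacitySAW
import HarnessLib.Audit.Status.Attr

/-!
Route: SAWBetheAnsatz

DORMANT since 2026-08-25T12:32:32Z (reconciler: no traction for 7.7 d (last activity item-evidence-added at 2026-08-17T19:14:41Z); parked, not closed — `ledger route dormant route-CriticalPhenomena-SAWBetheAnsatz --off` to reactivate) — unstaffed, not closed; items shared with open routes are served there. `ledger route dormant <id> --off` reactivates.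

# Route SAWBetheAnsatz — Compute 5/8 by rigorous Bethe ansatz at the integrable honeycomb point,
then tightness + identification + universality

It suffices to show X_B = (E) ∧ (T_H) ∧ (I_H) ∧ (U) [idea card
rigorous-bethe-ansatz-polymer-exponents: COMPUTE the polymer exponents on the integrable hexagonal
lattice instead of postulating them, then tightness + identification + universality]:
(E) EXPONENT ENGINE — rigorous Bethe ansatz for the n = 0 honeycomb loop model (= x_c-weighted
self-avoiding walks, x_c = 1/√(2+√2); Batchelor–Blöte periodic, Batchelor–Suzuki open boundaries),
read through Perron–Frobenius decay rates of nonnegative SAW transfer matrices with Cardy's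
finite-size dictionary used as a DEFINITION of the exponents: r2 StripGapFiveEighths (open strip of
T hexagon rows, one spanning walk: T·(rate per column) → π·x̃₁/(√3/2) = 5π/(4√3), i.e. the boundary
one-leg dimension x̃₁ = h_(2,1) = 5/8) and r3 CylinderWatermelonGaps (cylinder of perimeter P, k
mutually avoiding spanning walks: P·(rate per row) → √3·π·x_k, x_k = (9k²−4)/48: x₁ = 5/48 = η/2, x₂
= 2/3 = 2 − 1/ν).
(T_H) HexEventualTight — for every Dobrushin domain and hexagonal endpoint approximation the
critical hexagonal SAW laws (hexSAWLaw pushed to CurveClass ℂ), δ ∈ (0, δ₀], are tight; to be fed by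
(E) through annulus k-arm bounds (Aizenman–Burchard / Kemppainen–Smirnov G2).
(I_H) HexSubseqIdentification — every subsequential weak limit of those laws is the chordal
SLE_(8/3) law of the domain.
(U) LatticeUniversality — shared verbatim with route SAWHexUniversality
(stmt-CriticalPhenomena-0807): square- and hexagonal-lattice critical SAW laws are asymptotically
equal on bounded continuous test functions.
Lean: `StripGapFiveEighths ∧ CylinderWatermelonGaps ∧ HexEventualTight ∧ HexSubseqIdentification ∧
LatticeUniversality`

## Assembly
Fix a Dobrushin domain and a square-lattice endpoint approximation; pick a hexagonal approximation
(HexApproxExists). The hexagonal laws are eventually probability measures (reachability; finitely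
many SAWs in a bounded Ω_δ); HexEventualTight + Prokhorov (Mathlib
isCompact_closure_of_isTightMeasureSet; CurveClass ℂ Polish, CurveClass.polishSpace_holds) give
subsequential weak limits along any δ_n → 0⁺; HexSubseqIdentification makes each the SLE_(8/3) law,
unique by IsSLECurve.map_eq_holds and realised as preWienerMeasure.map Γ
(exists_isSLECurve_eightThirds); the subsequence principle for the countably generated filter 𝓝[>]0
gives TendstoLaw for the hexagonal laws; LatticeUniversality transfers the limit of every test
integral to the square-lattice laws (two-ε argument); AEMeasurable is automatic (discrete
σ-algebra); hence ConvergesInLawToSLE (8/3), i.e. SAWScalingLimit. Standard measure theory, no new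
mathematics.

Rationale: WHY THIS LINE. 5/8, 5/48 and 3/4 are used throughout the SAW programme (LawlerSchrammWerner2004SAW
restriction exponent; DuminilCopinSmirnov2012 Remark 2, arXiv:1007.0575 p.6: B_T(x_c) "should decay
as T^(-1/4)") but have no lattice proof on any lattice. At n = 0 the honeycomb loop model at x_c is
Yang–Baxter integrable (Nienhuis1982, Baxter1986) and was solved by coordinate Bethe ansatz: c = 0
and bulk watermelon x_k from finite-size spectra (BatchelorBlote1988, BatchelorBlote1989), FREE open
boundaries K_s = K are integrable (ordinary transition) with surface watermelons h_(l+1,1)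
(BatchelorSuzuki1993; Jacobsen2009 pp.394–395, eqs.(14.139)–(14.140): "established by Bethe Ansatz
techniques"), and one BA prediction of this family (BatchelorYung1995, y_c = 1+√2) has since been
PROVED (BeatonBousquetMelouDeGierDuminilCopinGuttmann2014). Meanwhile the six-vertex/XXZ Bethe
ansatz has become rigorous for leading eigenvalues: free energy
(DuminilCopinKozlowskiKrachunManolescuTikhonovskaia2022), the Perron–Frobenius identification
strategy (DuminilCopinGagnebinHarelManolescuTassion2018), 1/L excitation towers from root
condensation (Kozlowski2018). Imported area: quantum integrable systems (coordinate/algebraic BA,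
condensation, nonlinear integral equations) pointed at the one place where SAW is exactly
integrable; dictionary = finite-size scaling (Cardy1984; Di Francesco–Mathieu–Sénéchal §11.2, held
copy p.396: ξ_strip = 2L/(π η_∥), ξ_cyl = L/(2πΔ)) applied to Perron–Frobenius rates
(Derrida1981-style), no CFT assumed. What prior routes do not do: SAWHexUniversality quarantines all
of (H) in one crux; SAWParafermion/ConfRestriction/RestrictionRigidity work on ℤ² where no
integrability exists (barrier NienhuisWeightsExcludeVertexSAW); this route splits (H) into tightness
+ identification and attacks the exponent inputs of tightness by an exact-solution engine; the
refuted all-δ tightness (stmt-0772) is replaced by the ∃δ₀ form.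

RANKED CRUXES. #2 StripGapFiveEighths (crux) — In the HV coordinate model of the honeycomb lattice,
let W(T,N) be the sum of x_c^(#vertices) over self-avoiding walks confined to the parallelogram box
(columns 0 ≤ x₀ ≤ N, levels 0 ≤ lev ≤ 2T−1, i.e. T hexagon rows with free boundaries) from any
vertex of column 0 to any vertex of column N. Then for every ε > 0, for all large T, eventually in
N: |T·(−log W(T,N)/N) − 5π/(4√3)| ≤ ε. Equivalently the one-walk sector of the open-strip transfer
matrix has Cardy gap π·x̃₁/W_⊥ with x̃₁ = 5/8 (W_⊥ = (√3/2)T rows, column period 1 in the regular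
embedding). Card item r3 (open/Batchelor–Suzuki side, x̃₁ = 5/8). [difficulty: XL] (why it might
fail: PF eigenvector of the nonnegative walk TM must be matched to a Bethe vector of the
complex-weight open-boundary vertex TM (2-string roots at n=0); condensation and O(1/T) control
never done rigorously even for XXZ ground states; constant presumes aspect ratio √3/2.)
[BatchelorSuzuki1993, BatchelorYung1995, Jacobsen2009, Cardy1984, DuplantierSaleur1986,
Kozlowski2018, DuminilCopinGagnebinHarelManolescuTassion2018,
book:di-francesco1997-conformal-field-theory, Derrida1981]
#3 CylinderWatermelonGaps (crux) — On the honeycomb cylinder of perimeter P (HV model modulo the row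
translation x₀ ↦ x₀+P), let W_k(P,M) be the sum of x_c^(total #vertices) over ordered k-tuples of
pairwise vertex-disjoint self-avoiding walks from level 0 to level 2M−1 confined to levels 0..2M−1
(k mutually avoiding walks spanning M hexagon rows). Then for every k ≥ 1 and ε > 0, for all large
P, eventually in M: |P·(−log W_k(P,M)/M) − √3·π·(9k²−4)/48| ≤ ε — the k-leg watermelon dimensions
x_k = (9k²−4)/48 (x₁ = 5/48, x₂ = 2/3; = Literature.Barriers.CriticalPhenomena.legExponent (3/2) k)
as Cardy cylinder gaps 2π·x_k/P per unit length (row height √3/2), measured from the trivial n = 0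
vacuum Λ₀ = 1. Card item r2 (periodic/Batchelor–Blöte side). [difficulty: XL] (why it might fail:
Per-sector PF/Bethe identification and root condensation for every k-leg sector (excited states of
the full TM, where even XXZ lacks ground-state identification, Kozlowski2018); all k ≥ 1 claimed
with P₀ depending on k; constant presumes aspect ratio √3/2.) [BatchelorBlote1988,
BatchelorBlote1989, Saleur1986, Jacobsen2009, Nienhuis1982, Baxter1986,
DuminilCopinKozlowskiKrachunManolescuTikhonovskaia2022, Kozlowski2018,
Literature.Barriers.CriticalPhenomena.legExponent]
#4 HexEventualTight (crux) — For every Dobrushin domain D and hexagonal endpoint approximation (a_δ,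
b_δ) (IsEmbEndpointApprox hexGraph hexCenter) there is δ₀ > 0 such that the push-forwards to
CurveClass ℂ of the critical hexagonal SAW laws hexSAWLaw D δ a_δ b_δ, δ ∈ (0, δ₀], form a tight set
of measures. Intended proof: annulus k-crossing bounds for x_c-SAW on Hex with exponents λ_k → ∞
(from r3's rates, even the trivial λ_k ≥ k·λ₁, PLUS an arm-separation/quasi-multiplicativity lemma)
fed into Aizenman–Burchard regularity / Kemppainen–Smirnov Thm 1.5. The ∃δ₀ form avoids the witness
that refuted the all-δ statement stmt-CriticalPhenomena-0772. [deps: CylinderWatermelonGaps]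
[difficulty: open-problem] (why it might fail: SAW has no FKG/RSW: converting cylinder rates into
annulus-crossing PROBABILITY bounds uniform over rough slit domains (arm separation) is open;
strongest known input is sub-ballisticity (DuminilCopinHammond2013, arXiv:2310.17299).)
[AizenmanBurchard1999, KemppainenSmirnov2017, DuminilCopinHammond2013, arXiv:2310.17299,
Summit.CriticalPhenomena.SAWScalingLimit.Theorems.SAWParafermionTight_refuted]
#5 HexSubseqIdentification (crux) — For every Dobrushin domain D, hexagonal endpoint approximation
(a_δ, b_δ), sequence s_n → 0⁺ and probability measure μ on CurveClass ℂ: if the test integrals ∫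
f∘curve d(hexSAWLaw D (s n) …) converge to ∫ f dμ for every bounded continuous f, then μ is the
chordal SLE_(8/3) law of D (IsSLELaw (8/3) D μ). This is Duminil-Copin–Smirnov Conjecture 1 minus
precompactness; inputs foreseen: parafermionic observable / restriction programmes on Hex (sibling
routes), with r2's x̃₁ = 5/8 as the independently computed boundary exponent. [difficulty:
open-problem] (why it might fail: Equals DCS Conj. 1 minus tightness: the parafermion obeys only
half of discrete Cauchy–Riemann (barrier ParafermionicHalfCauchyRiemann); SLE(8/3) is known only for
conformally covariant limits (LSW04); exponents alone do not identify a law.)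
[DuminilCopinSmirnov2012, LawlerSchrammWerner2004SAW,
Literature.Barriers.CriticalPhenomena.ParafermionicHalfCauchyRiemann,
Literature.Probability.RandomPlanarGeometry.SAW.HexSAWScalingLimit]
#6 LatticeUniversality (crux) — (Shared verbatim with route SAWHexUniversality, item
stmt-CriticalPhenomena-0807.) For every Dobrushin domain, every square-lattice endpoint
approximation (a_δ, b_δ) and every hexagonal one (a'_δ, b'_δ), and every bounded continuous f on
CurveClass ℂ: ∫ f∘curve dP^(ℤ²)_δ − ∫ f∘curve dP^(Hex)_δ → 0 as δ → 0⁺. [difficulty: open-problem]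
(why it might fail: Uniform ℤ² SAW is in no Yang–Baxter family (GlazmanManolescu2019 p.1; barrier
NienhuisWeightsExcludeVertexSAW): no transfer tool reaches it; lattice effects persist in limits of
boundary SAW ensembles (KennedyLawler2013); needs tightness on both lattices.)
[GlazmanManolescu2019, KennedyLawler2013, DuminilCopinSmirnov2012,
Literature.Barriers.CriticalPhenomena.NienhuisWeightsExcludeVertexSAW]
#9 BridgeExponentQuarter (support) — Duminil-Copin–Smirnov's bridge partition function B_T(x_c) =
HV.stripBlim T (proved: c/T ≤ B_T ≤ 1 and B_T → 0, tendsto_stripBlim) satisfies log B_T / log T →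
−1/4, i.e. B_T = T^(−1/4+o(1)) (DCS Remark 2, from 1 − 2·x̃₁ with x̃₁ = 5/8). The card's B3 output
wanted by the renewal cards (kesten-renewal-stable-skeleton, saw-rsw-from-kesten-renewal-tightness);
needs r2's gap plus control of the amplitude (form factors), hence support, not crux. [difficulty:
XL] [DuminilCopinSmirnov2012, LawlerSchrammWerner2004SAW,
BeatonBousquetMelouDeGierDuminilCopinGuttmann2014]
#9 StripRateExists (support) — For every T ≥ 1 the per-column decay rate of the one-walk strip
partition function of r2 exists: −log W(T,N)/N converges as N → ∞ (finite nonnegative transfer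
matrix on walk sections / Fekete; Alm–Janson rationality of strip generating functions). First bite
of r2, provable now. [difficulty: provable-now] [MadrasSlade1993, Alm1993, Derrida1981]
#9 HexApproxExists (support) — Every Dobrushin domain admits a hexagonal-lattice endpoint
approximation: maps a, b : ℝ → HexVertex with IsEmbEndpointApprox hexGraph hexCenter D a b (points
of the largest component Ω_δ ⊆ δℍ joined in Ω_δ for small δ and converging to the two marked prime
ends; accessibility of boundary points of Jordan domains). [difficulty: M] [DuminilCopinSmirnov2012,
Literature.Probability.RandomPlanarGeometry.SAW.IsEmbEndpointApprox]

TWO-LAYER PLAN. HexEventualTight ⇐ ArmSeparationHex (k-crossing probability of an annulus by the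
critical Hex SAW ≤ C(r/R)^(λ_k), λ_k → ∞, uniformly over slit domains and conditioning) →
ABRegularityHex (Aizenman–Burchard/KS: such bounds ⇒ eventual tightness) → HexEventualTight.
StripGapFiveEighths ⇐ BetheIdentification (for each T the PF eigenvalue of the one-walk open-strip
TM is the Bethe eigenvalue of an explicit root configuration) → RootCondensation (the roots condense
with O(1/T)-controlled corrections giving gap = π(5/8)/W_⊥) → StripGapFiveEighths.
CylinderWatermelonGaps ⇐ (k = 1, 2) → (general k) if provers ask.

KILL CRITERIA. (i) FEASIBILITY (closes the BA line → exhausted): write the n = 0, k = 1 Bethe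
equations (cylinder; then Batchelor–Suzuki open strip) and check numerically for widths ≤ 64 that
the Perron–Frobenius eigenvalue of the walk TM IS a Bethe eigenvalue with a condensing root pattern
of the kind the XXZ analysis handles; exotic/non-condensing patterns for the leading sector retire
r2/r3 as Bethe targets. (ii) AS-TYPED constants: a transfer-matrix extrapolation (T ≤ 12) of T·g_T
landing > 3% from 5π/(4√3) ≈ 2.2672, or of P·g_(1,P) from 5√3π/48 ≈ 0.5668, refutes r2/r3 as typed —
almost surely a planner normalisation slip, repaired by restating the constant; the exponent content
survives iff the strip : cyl(k=1) : cyl(k=2) limits are in ratio 30 : 5 : 32. (iii)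
¬HexEventualTight or ¬LatticeUniversality would refute much more than this route (pivot: none;
close). (iv) If SAWHexUniversality's HexConjecture closes by other means, r4/r5 are mooted and the
route reduces to its stand-alone theorems r2/r3/BridgeExponentQuarter.

NOT DECOMPOSED YET. Everything inside r2/r3 (Bethe equations at finite size, PF identification,
condensation, Euler–Maclaurin/NLIE asymptotics) — layer-2 children once a prover reports the root
structure; the arm-separation lemma behind r4 (see Two-layer plan); the form-factor/amplitude step
from r2 to BridgeExponentQuarter; endpoint/finiteness bookkeeping inside the Assembly. No Target
decl: X_B is the conjunction of the cruxes. No definition requests: all objects are typed inline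
over the HV coordinate model (finite sums), hexSAWLaw and CurveClass.

CHEAPEST FALSIFIER. Exact enumeration / transfer-matrix computation of W(T,N) (strip) and W_1(P,M)
(cylinder) for small widths, extrapolating T·g_T and P·g_P: disagreement with 5π/(4√3) ≈ 2.2672
resp. 5√3π/48 ≈ 0.5668 beyond a few percent kills the typed constants (not the line). RUN THIS
SESSION (planner, brute-force DFS in Python on the exact HV finsets of the Lean statements, x_c
weights per vertex; scratch/sawstrip.py, scratch/sawcyl.py in the planner folder): strip per-column
rates g_2 = 0.7954, g_3 = 0.5889, g_4 ≈ 0.467 (N ≤ 9, 8, 7), two-point fits g_T = c/(T+a) give c =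
2.27 (T=2,3; a = 0.85) and c = 2.30 (T=3,4, g_4 under-converged in N) vs 2.2672 predicted; cylinder
k = 1 per-row rates give P·g_P = 0.5600 (P=3), 0.5622 (P=4), 0.5637 (P=5, M ≤ 5), increasing towards
0.5668. Both normalisations (column period 1, row height √3/2; π x̃/W vs 2π x/P) are thus consistent
with the data at the percent level. The feasibility check (i) of the kill criteria (Bethe roots of
the PF eigenvalue at n = 0) is the cheapest falsifier of the MECHANISM and was not run.

NUMBERS. x_c = 1/√(2+√2) (DuminilCopinSmirnov2012 Thm 1, proved in tree:
DuminilCopinSmirnov2012_thm1_holds); x̃_l = l(3l+2)/8 = h_(l+1,1) (x̃₁ = 5/8, x̃₂ = 2), x_l =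
(9l²−4)/48 = 2h_(l/2,0) (x₁ = 5/48, x₂ = 2/3) (DuplantierSaleur1986, Saleur1986, Jacobsen2009 eqs.
(14.81), (14.139)); ξ_strip = L/(π x̃), ξ_cyl = L/(2π x) (Cardy1984; DMS p.396); honeycomb aspect
ratios: column period 1, hexagon-row height √3/2 (regular embedding); targets 5π/(4√3) ≈ 2.26725,
√3π(9k²−4)/48 (k=1: ≈ 0.56680; k=2: ≈ 3.62760); B_T exponent −1/4 = 1 − 2·(5/8); c/T ≤ B_T ≤ 1 (DCS
Remark 2, in tree). Planner numerics (this session): strip T·g_T → ≈2.27 (fit), cylinder P·g_P =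
0.560, 0.562, 0.564 for P = 3, 4, 5.

DEFINITION REQUESTS. None. (Cite fact that would help provers, not load-bearing: Kemppainen–Smirnov
2017 Thm 1.5 "G2 ⇒ tightness" as a named fact over
Literature.Probability.RandomPlanarGeometry.ConditionG2 — already wanted as wi-04958 by route
SAWParafermion.)

Novelty: Searches (2026-08-15): lit search --source crossref "Batchelor Blote honeycomb O(n) model Bethe
ansatz" (10 hits: physics BA incl. doi:10.1103/physrevlett.62.2425; no rigorous entry); crossref
"Kozlowski condensation Bethe roots XXZ" (→ doi:10.1007/s00220-017-3066-8); zbMATH "Izergin-Korepin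
Bethe ansatz completeness rigorous" (0); lit search --hybrid "Bethe ansatz honeycomb O(n) loop model
finite-size spectrum watermelon" (12 held textbooks: Korepin–Bogoliubov–Izergin, Essler et al.,
Jacobsen2009 — physics level for O(n)); crossref "self-avoiding walk strip transfer matrix
correlation length surface exponent" (Saleur–Derrida 1986 TM numerics, Kennedy CI tests —
numerical); lit frontier CriticalPhenomena --since 2020 (30 descendants; only Hex-SAW entry
arXiv:2310.17299 sub-ballisticity; no BA-for-SAW); lit bridges CriticalPhenomena --cross any
(Peled–Spinka arXiv:1708.00058 loop O(n) lectures: qualitative rigorous results, no exponents); lit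
galaxy search --star all "Bethe ansatz solution of the O(n) model on the honeycomb lattice" and
"rigorous Bethe ansatz" (4 irrelevant hits; crabby saturated); plus the card's own searches and its
refuter novelty audit (grade new-combination).
Nearest prior art found: BatchelorBlote1988 / BatchelorBlote1989 / BatchelorSuzuki1993 (the exact
but non-rigorous BA solution of the honeycomb O(n) model, bulk and open boundaries) and
Kozlowski2018 + DuminilCopinKozlowskiKrachunManolescuTikhonovskaia2022 +
DuminilCopinGagnebinHarelManolescuTassion2  [refs: 10.1103/physrevlett.62.2425, 10.1007/s00220-017-3066-8, 2310.17299, 1708.00058, doi:10.1103/physrevlett.62.2425, doi:10.1007/s00220-017-3066-8, Jacobsen2009, BatchelorBlote1988, BatchelorBlote1989, BatchelorSuzuki1993, Kozlowski2018, DuminilCopinGagnebinHarelManolescuTassion2018]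

Barriers (technique_class: bethe-ansatz-rigorous, transfer-matrix-spectrum, yang-baxter): - technique_class: bethe-ansatz-rigorous, transfer-matrix-spectrum, yang-baxter
- Literature.Barriers.CriticalPhenomena.NienhuisWeightsExcludeVertexSAW: applies to any use of
integrability on the uniform ℤ² walk (not_hasExactVertexRelationZ2); evaded by design — every BA
statement lives on the honeycomb (HV model), ℤ² is reached only through the comparison crux r6 (no
identities on ℤ²).
- Literature.Barriers.CriticalPhenomena.ParafermionicHalfCauchyRiemann: applies to r5 (the DCS
observable alone is under-determined); it does not bear on r2/r3 (the BA uses the full commuting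
transfer-matrix structure, strictly more than the vertex relation) but r2/r3 yield exponents, not
conformal covariance, so for r5 it is NOT evaded: quarantined there, shared with every Hex route;
the bet is that identification falls to observable+restriction input with 5/8 supplied
independently.
- Literature.Barriers.CriticalPhenomena.SAWNoUnitaryCFT: Cardy's gap dictionary is used as a
definition through Perron–Frobenius eigenvalues of nonnegative matrices; no unitary Virasoro module
is posited; c = 0 appears as the trivial vacuum Λ₀ = 1 and rates are measured from 0 (explicit in
r2/r3); the file's legExponent (3/2) k is r3's constant.
- Literature.Barriers.CriticalPhenomena.SupercriticalSAWSpaceFilling: everything at x = x_c(Hex)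
exactly; no x > x_c statement.
- Literature.Barriers.CriticalPhenomena.EmbeddingModulusUniqueness: no embedding-blind claim of
conformal invariance; rotational/conformal input

Novelty grade: new-combination — ROUTE REVIEW (refuter rreview-5065e3d8, 08-15). Grade = card audit's new-combination, confirmed: (non-rigorous BA of honeycomb O(n), bulk + open boundary) + (rigorous BA/PF technology for six-vertex/XXZ) at the n = 0 integrable point, on the DCS Hex-transfer skeleton; searchd down, crossref spot-che (refuter refuter-rreview-route-CriticalPhenomena--5065e3d8-0, 2026-08-15T14:01:38Z; prior: BatchelorBlote1988, BatchelorSuzuki1993, doi:10.1103/physrevlett.74.2026, Kozlowski2018, DuminilCopinKozlowskiKrachunManolescuTikhonovskaia2022, DuminilCopinSmirnov2012, DuplantierSaleur1986)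

History (route lifecycle, newest last):
- 2026-08-25T12:32:32Z · DORMANT — reconciler: no traction for 7.7 d (last activity item-evidence-added at 2026-08-17T19:14:41Z); parked, not closed — `ledger route dormant route-CriticalPhenomen (operator:999:3786985)

sub-problem: SAWScalingLimit · status: dormant · opened planner-plancard-CriticalPhenomena-SAWScaling-e44d9ab7-0 2026-08-15T11:38:52Z · rev 4 · ledger route-CriticalPhenomena-SAWBetheAnsatz
GENERATED by the gate from the ledger (D-0016/17). Provers cite these decls: `theorem foo : Summit.CriticalPhenomena.SAWScalingLimit.Theses.SAWBetheAnsatz.<Decl> := …` in Summits/CriticalPhenomena/SAWScalingLimit/Theorems/<Name>.lean.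
-/

namespace Summit.CriticalPhenomena.SAWScalingLimit.Theses.SAWBetheAnsatz

open scoped BigOperators Topology Manifold Classical MeasureTheory ProbabilityTheory Matrix InnerProductSpace ComplexConjugate ContinuousMap
open Filter Set Function TopologicalSpace MeasureTheory

attribute [summit_statement] _root_.SAWScalingLimit

/-- item stmt-CriticalPhenomena-4995 · crux · rank 2 · open · by planner
why it might fail: PF eigenvector of the nonnegative walk TM must be matched to a Bethe vector of the complex-weight open-boundary vertex TM (2-string roots at n=0); condensation and O(1/T) control never done rigorously even for XXZ ground states; constant presumes aspect ratio √3/2.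
sources: BatchelorSuzuki1993, BatchelorYung1995, Jacobsen2009, Cardy1984, DuplantierSaleur1986, Kozlowski2018
[crux] In the HV coordinate model of the honeycomb lattice, let W(T,N) be the sum of x_c^(#vertices)
over self-avoiding walks confined to the parallelogram box (columns 0 ≤ x₀ ≤ N, levels 0 ≤ lev ≤
2T−1, i.e. T hexagon rows with free boundaries) from any vertex of column 0 to any vertex of column
N. Then for every ε > 0, for all large T, eventually in N: |T·(−log W(T,N)/N) − 5π/(4√3)| ≤ ε.
Equivalently the one-walk sector of the open-strip transfer matrix has Cardy gap π·x̃₁/W_⊥ with x̃₁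
= 5/8 (W_⊥ = (√3/2)T rows, column period 1 in the regular embedding). Card item r3
(open/Batchelor–Suzuki side, x̃₁ = 5/8). [difficulty: XL] -/
@[route_item "route-CriticalPhenomena-SAWBetheAnsatz"]
def StripGapFiveEighths : Prop :=
  let box : ℕ → ℕ → Finset Literature.Probability.RandomPlanarGeometry.SAW.HV := fun T N => ((Finset.Icc (0 : ℤ) N) ×ˢ (Finset.Icc (0 : ℤ) T) ×ˢ (Finset.univ : Finset Bool)).filter (fun v => Literature.Probability.RandomPlanarGeometry.SAW.HV.lev v ≤ 2 * (T : ℤ) - 1); let walks : ℕ → ℕ → Finset (List Literature.Probability.RandomPlanarGeometry.SAW.HV) := fun T N => ((box T N).filter (fun v => v.1 = 0)).biUnion (fun v => (Literature.Probability.RandomPlanarGeometry.SAW.HV.sawsUpTo v (box T N).card).filter (fun l => (∀ u ∈ l, u ∈ box T N) ∧ ∃ u ∈ l.getLast?, u.1 = (N : ℤ))); let W : ℕ → ℕ → ℝ := fun T N => ∑ l ∈ walks T N, Literature.Probability.RandomPlanarGeometry.SAW.hexCriticalFugacity ^ l.length; ∀ ε > (0 : ℝ), ∃ T₀ : ℕ,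 ∀ T ≥ T₀, ∀ᶠ N : ℕ in Filter.atTop, |(T : ℝ) * (-Real.log (W T N) / N) - 5 * Real.pi / (4 * Real.sqrt 3)| ≤ ε

/-- item stmt-CriticalPhenomena-4996 · crux · rank 3 · open · by planner
why it might fail: Per-sector PF/Bethe identification and root condensation for every k-leg sector (excited states of the full TM, where even XXZ lacks ground-state identification, Kozlowski2018); all k ≥ 1 claimed with P₀ depending on k; constant presumes aspect ratio √3/2.
sources: BatchelorBlote1988, BatchelorBlote1989, Saleur1986, Jacobsen2009, Nienhuis1982, Baxter1986
[crux] On the honeycomb cylinder of perimeter P (HV model modulo the row translation x₀ ↦ x₀+P), let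
W_k(P,M) be the sum of x_c^(total #vertices) over ordered k-tuples of pairwise vertex-disjoint
self-avoiding walks from level 0 to level 2M−1 confined to levels 0..2M−1 (k mutually avoiding walks
spanning M hexagon rows). Then for every k ≥ 1 and ε > 0, for all large P, eventually in M: |P·(−log
W_k(P,M)/M) − √3·π·(9k²−4)/48| ≤ ε — the k-leg watermelon dimensions x_k = (9k²−4)/48 (x₁ = 5/48, x₂
= 2/3; = Literature.Barriers.CriticalPhenomena.legExponent (3/2) k) as Cardy cylinder gaps 2π·x_k/P
per unit length (row height √3/2), measured from the trivial n = 0 vacuum Λ₀ = 1. Card item r2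
(periodic/Batchelor–Blöte side). [difficulty: XL] -/
@[route_item "route-CriticalPhenomena-SAWBetheAnsatz"]
def CylinderWatermelonGaps : Prop :=
  let cyl : ℕ → ℕ → Finset (List Literature.Probability.RandomPlanarGeometry.SAW.HV) := fun P M => ((Finset.range P).biUnion (fun i => Literature.Probability.RandomPlanarGeometry.SAW.HV.sawsUpTo (((i : ℕ) : ℤ), (0 : ℤ), false) (2 * M * P))).filter (fun l => (∀ u ∈ l, 0 ≤ u.2.1 ∧ Literature.Probability.RandomPlanarGeometry.SAW.HV.lev u ≤ 2 * (M : ℤ) - 1) ∧ l.Pairwise (fun u w => ¬ ((P : ℤ) ∣ (u.1 - w.1) ∧ u.2 = w.2)) ∧ ∃ u ∈ l.getLast?, Literature.Probability.RandomPlanarGeometry.SAW.HV.lev u = 2 * (M : ℤ) - 1); let W : (k : ℕ) → ℕ → ℕ → ℝ := fun k P M => ∑ t ∈ (Fintype.piFinset (fun _ : Fin k => cyl P M)).filter (fun t => ∀ i j : Fin k, i ≠ j → ∀ u ∈ t i, ∀ w ∈ t j, ¬ ((P : ℤ) ∣ (u.1 - w.1) ∧ u.2 = w.2)), Literature.Probability.RandomPlanarGeometry.SAW.hexCriticalFugacity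 ^ (∑ i, (t i).length); ∀ k : ℕ, 1 ≤ k → ∀ ε > (0 : ℝ), ∃ P₀ : ℕ, ∀ P ≥ P₀, ∀ᶠ M : ℕ in Filter.atTop, |(P : ℝ) * (-Real.log (W k P M) / M) - Real.sqrt 3 * Real.pi * (9 * (k : ℝ) ^ 2 - 4) / 48| ≤ ε

/-- item stmt-CriticalPhenomena-4997 · crux · rank 4 · open · by planner
why it might fail: SAW has no FKG/RSW: converting cylinder rates into annulus-crossing PROBABILITY bounds uniform over rough slit domains (arm separation) is open; strongest known input is sub-ballisticity (DuminilCopinHammond2013, arXiv:2310.17299).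
sources: AizenmanBurchard1999, KemppainenSmirnov2017, DuminilCopinHammond2013, arXiv:2310.17299, Summit.CriticalPhenomena.SAWScalingLimit.Theorems.SAWParafermionTight_refuted
[crux] For every Dobrushin domain D and hexagonal endpoint approximation (a_δ, b_δ)
(IsEmbEndpointApprox hexGraph hexCenter) there is δ₀ > 0 such that the push-forwards to CurveClass ℂ
of the critical hexagonal SAW laws hexSAWLaw D δ a_δ b_δ, δ ∈ (0, δ₀], form a tight set of measures.
Intended proof: annulus k-crossing bounds for x_c-SAW on Hex with exponents λ_k → ∞ (from r3's
rates, even the trivial λ_k ≥ k·λ₁, PLUS an arm-separation/quasi-multiplicativity lemma) fed into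
Aizenman–Burchard regularity / Kemppainen–Smirnov Thm 1.5. The ∃δ₀ form avoids the witness that
refuted the all-δ statement stmt-CriticalPhenomena-0772. [deps: CylinderWatermelonGaps] [difficulty:
open-problem] -/
@[route_item "route-CriticalPhenomena-SAWBetheAnsatz", crux]
def HexEventualTight : Prop :=
  ∀ (D : Literature.Probability.RandomPlanarGeometry.DobrushinDomain) (a b : ℝ → Literature.Probability.LatticeModels.HexVertex), Literature.Probability.RandomPlanarGeometry.SAW.IsEmbEndpointApprox Literature.Probability.LatticeModels.hexGraph Literature.Probability.LatticeModels.hexCenter D a b → ∃ δ₀ : ℝ, 0 < δ₀ ∧ MeasureTheory.IsTightMeasureSet ((fun δ : ℝ => (Literature.Probability.RandomPlanarGeometry.SAW.hexSAWLaw D.carrier δ (a δ) (b δ)).map (fun γ => γ.curve)) '' Set.Ioc 0 δ₀)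

/-- item stmt-CriticalPhenomena-4998 · crux · rank 5 · open · by planner
why it might fail: Equals DCS Conj. 1 minus tightness: the parafermion obeys only half of discrete Cauchy–Riemann (barrier ParafermionicHalfCauchyRiemann); SLE(8/3) is known only for conformally covariant limits (LSW04); exponents alone do not identify a law.
sources: DuminilCopinSmirnov2012, LawlerSchrammWerner2004SAW, arXiv:2310.17299, Literature.Barriers.CriticalPhenomena.ParafermionicHalfCauchyRiemann
[crux] For every Dobrushin domain D, hexagonal endpoint approximation (a_δ, b_δ), sequence s_n → 0⁺
and probability measure μ on CurveClass ℂ: if the test integrals ∫ f∘curve d(hexSAWLaw D (s n) …)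
converge to ∫ f dμ for every bounded continuous f, then μ is the chordal SLE_(8/3) law of D
(IsSLELaw (8/3) D μ). This is Duminil-Copin–Smirnov Conjecture 1 minus precompactness; inputs
foreseen: parafermionic observable / restriction programmes on Hex (sibling routes), with r2's x̃₁ =
5/8 as the independently computed boundary exponent. [difficulty: open-problem] -/
@[route_item "route-CriticalPhenomena-SAWBetheAnsatz", crux]
def HexSubseqIdentification : Prop :=
  ∀ (D : Literature.Probability.RandomPlanarGeometry.DobrushinDomain) (a b : ℝ → Literature.Probability.LatticeModels.HexVertex), Literature.Probability.RandomPlanarGeometry.SAW.IsEmbEndpointApprox Literature.Probability.LatticeModels.hexGraph Literature.Probability.LatticeModels.hexCenter D a b → ∀ (s : ℕ → ℝ) (μ : MeasureTheory.Measure (Literature.Probability.RandomPlanarGeometry.CurveClass ℂ)), Filter.Tendsto s Filter.atTop (nhdsWithin 0 (Set.Ioi 0)) → MeasureTheory.IsProbabilityMeasure μ → (∀ f : BoundedContinuousFunction (Literature.Probability.RandomPlanarGeometry.CurveClass ℂ) ℝ, Filter.Tendsto (fun n => ∫ γ, f γ.curve ∂(Literature.Probability.RandomPlanarGeometry.SAW.hexSAWLaw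 D.carrier (s n) (a (s n)) (b (s n)))) Filter.atTop (nhds (∫ x, f x ∂μ))) → Literature.Probability.RandomPlanarGeometry.IsSLELaw ((8 : NNReal) / 3) D μ

/-- item stmt-CriticalPhenomena-0807 · crux · rank 6 · open · by planner
why it might fail: Uniform ℤ² SAW is in no Yang–Baxter family (GlazmanManolescu2019 p.1; barrier NienhuisWeightsExcludeVertexSAW): no transfer tool reaches it; lattice effects persist in limits of boundary SAW ensembles (KennedyLawler2013); needs tightness on both lattices.
sources: GlazmanManolescu2019, KennedyLawler2013, DuminilCopinSmirnov2012, Literature.Barriers.CriticalPhenomena.NienhuisWeightsExcludeVertexSAW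
[crux] r2 (hardest, most informative; informal until defn HexSAWLaw lands): lattice universality of
the chordal critical SAW law — for every Dobrushin domain (Ω; a, b), every square-lattice endpoint
approximation (a_δ, b_δ) (Literature.Probability.RandomPlanarGeometry.SAW.IsEndpointApprox) and
every hexagonal-lattice endpoint approximation (a'_δ, b'_δ), and every bounded continuous f on
CurveClass ℂ: ∫ f∘curve dP^{Z^2}_{x_c(Z^2),δ} − ∫ f∘curve dP^{Hex}_{x_c(Hex),δ} → 0 as δ → 0+
(x_c(Hex) = 1/√(2+√2), Duminil-Copin–Smirnov 2012 Thm 1). Tool: Yang–Baxter track exchange on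
rhombic tilings (Glazman–Manolescu arXiv:1708.00395 §3), which so far controls boundary two-point
functions, not curve laws. -/
@[route_item "route-CriticalPhenomena-SAWBetheAnsatz", crux]
def LatticeUniversality : Prop :=
  ∀ (D : Literature.Probability.RandomPlanarGeometry.DobrushinDomain) (a b : ℝ → Literature.Probability.LatticeModels.Site 2) (a' b' : ℝ → Literature.Probability.LatticeModels.HexVertex), Literature.Probability.RandomPlanarGeometry.SAW.IsEndpointApprox D a b → Literature.Probability.RandomPlanarGeometry.SAW.IsEmbEndpointApprox Literature.Probability.LatticeModels.hexGraph Literature.Probability.LatticeModels.hexCenter D a' b' → ∀ f : BoundedContinuousFunction (Literature.Probability.RandomPlanarGeometry.CurveClass ℂ) ℝ, Filter.Tendsto (fun δ => (∫ γ, f γ.curve ∂(Literature.Probability.RandomPlanarGeometry.SAW.law D.carrier δ (a δ) (b δ))) - ∫ γ, f γ.curve ∂(Literature.Probability.RandomPlanarGeometry.SAW.hexSAWLaw D.carrier δ (a' δ) (b' δ))) (nhdsWithin 0 (Set.Ioi 0)) (nhds 0)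

/-- item stmt-CriticalPhenomena-4999 · support · rank 9 · open · by planner
sources: DuminilCopinSmirnov2012, LawlerSchrammWerner2004SAW, BeatonBousquetMelouDeGierDuminilCopinGuttmann2014
[support] Duminil-Copin–Smirnov's bridge partition function B_T(x_c) = HV.stripBlim T (proved: c/T ≤
B_T ≤ 1 and B_T → 0, tendsto_stripBlim) satisfies log B_T / log T → −1/4, i.e. B_T = T^(−1/4+o(1))
(DCS Remark 2, from 1 − 2·x̃₁ with x̃₁ = 5/8). The card's B3 output wanted by the renewal cards
(kesten-renewal-stable-skeleton, saw-rsw-from-kesten-renewal-tightness); needs r2's gap plus control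
of the amplitude (form factors), hence support, not crux. [difficulty: XL] -/
@[route_item "route-CriticalPhenomena-SAWBetheAnsatz"]
def BridgeExponentQuarter : Prop :=
  Filter.Tendsto (fun T : ℕ => Real.log (Literature.Probability.RandomPlanarGeometry.SAW.HV.stripBlim T) / Real.log (T : ℝ)) Filter.atTop (nhds (-(1 / 4 : ℝ)))

/-- item stmt-CriticalPhenomena-5000 · support · rank 9 · open · by planner
sources: MadrasSlade1993, Alm1993, Derrida1981
[support] For every T ≥ 1 the per-column decay rate of the one-walk strip partition function of r2
exists: −log W(T,N)/N converges as N → ∞ (finite nonnegative transfer matrix on walk sections /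
Fekete; Alm–Janson rationality of strip generating functions). First bite of r2, provable now.
[difficulty: provable-now] -/
@[route_item "route-CriticalPhenomena-SAWBetheAnsatz"]
def StripRateExists : Prop :=
  let box : ℕ → ℕ → Finset Literature.Probability.RandomPlanarGeometry.SAW.HV := fun T N => ((Finset.Icc (0 : ℤ) N) ×ˢ (Finset.Icc (0 : ℤ) T) ×ˢ (Finset.univ : Finset Bool)).filter (fun v => Literature.Probability.RandomPlanarGeometry.SAW.HV.lev v ≤ 2 * (T : ℤ) - 1); let walks : ℕ → ℕ → Finset (List Literature.Probability.RandomPlanarGeometry.SAW.HV) := fun T N => ((box T N).filter (fun v => v.1 = 0)).biUnion (fun v => (Literature.Probability.RandomPlanarGeometry.SAW.HV.sawsUpTo v (box T N).card).filter (fun l => (∀ u ∈ l, u ∈ box T N) ∧ ∃ u ∈ l.getLast?, u.1 = (N : ℤ))); let W : ℕ → ℕ → ℝ := fun T N => ∑ l ∈ walks T N, Literature.Probability.RandomPlanarGeometry.SAW.hexCriticalFugacity ^ l.length; ∀ T : ℕ, 1 ≤ T → ∃ g : ℝ, Filter.Tendsto (fun N : ℕ => -Real.log (W T N) / N) Filter.atTop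 (nhds g)

/-- item stmt-CriticalPhenomena-5001 · support · rank 9 · open · by planner
sources: DuminilCopinSmirnov2012, Literature.Probability.RandomPlanarGeometry.SAW.IsEmbEndpointApprox
[support] Every Dobrushin domain admits a hexagonal-lattice endpoint approximation: maps a, b : ℝ →
HexVertex with IsEmbEndpointApprox hexGraph hexCenter D a b (points of the largest component Ω_δ ⊆
δℍ joined in Ω_δ for small δ and converging to the two marked prime ends; accessibility of boundary
points of Jordan domains). [difficulty: M] -/
@[route_item "route-CriticalPhenomena-SAWBetheAnsatz", crux]
def HexApproxExists : Prop :=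
  ∀ D : Literature.Probability.RandomPlanarGeometry.DobrushinDomain, ∃ a b : ℝ → Literature.Probability.LatticeModels.HexVertex, Literature.Probability.RandomPlanarGeometry.SAW.IsEmbEndpointApprox Literature.Probability.LatticeModels.hexGraph Literature.Probability.LatticeModels.hexCenter D a b

/-- item stmt-CriticalPhenomena-5002 · assembly · rank 1 · open · by planner
sources: KemppainenSmirnov2017, LawlerSchrammWerner2004SAW, DuminilCopinSmirnov2012
[assembly] HexEventualTight → HexSubseqIdentification → LatticeUniversality → HexApproxExists →
SAWScalingLimit. -/
@[route_item "route-CriticalPhenomena-SAWBetheAnsatz"]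
def Assembly : Prop :=
  HexEventualTight → HexSubseqIdentification → LatticeUniversality → HexApproxExists → SAWScalingLimit

/-! D-0027 §2.1 — DECIDING THEOREM (planner-authored via `route open/edit --closes-file`; by planner-rbadge-CriticalPhenomena-SAWBetheAnsat-ec7793b2-g4-0 2026-08-15T16:55:20Z):
its hypotheses are this route's items and its conclusion the sub-problem Statement (glue_lint), and it elaborates with this file. -/

@[closes "route-CriticalPhenomena-SAWBetheAnsatz"] theorem closes (hT : HexEventualTight) (hI : HexSubseqIdentification) (hU : LatticeUniversality)
    (hA : HexApproxExists) : _root_.SAWScalingLimit := by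
  classical
  -- vertices of a walk of a discrete domain `Ω_δ`, other than its start, lie in `Ω_δ`
  have support_sub : ∀ {V : Type} (G : SimpleGraph V) (emb : V → ℂ) (Ω : Set ℂ) (δ : ℝ) {u w : V}
      (p : (Literature.Probability.RandomPlanarGeometry.SAW.embDomainGraph G emb Ω δ).Walk u w),
      ∀ v ∈ p.support, v = u ∨ v ∈ Literature.Probability.RandomPlanarGeometry.SAW.embMeshDomain G emb Ω δ := by
    intro V G emb Ω δ u w p
    induction p with
    | nil => intro v hv; left; simpa using hv
    | @cons x y z h q ih =>
      intro v hv
      rw [SimpleGraph.Walk.support_cons, List.mem_cons] at hv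
      rcases hv with rfl | hv
      · exact Or.inl rfl
      · right
        rcases ih v hv with rfl | hv'
        · exact ((Literature.Probability.RandomPlanarGeometry.SAW.embDomainGraph_adj_iff G emb).1 h).2.2
        · exact hv'
  -- finitely many mesh vertices ⇒ finitely many SAWs of `Ω_δ` between two vertices
  have finite_saw : ∀ {V : Type} (G : SimpleGraph V) (emb : V → ℂ) (Ω : Set ℂ) (δ : ℝ) (a b : V),
      (Literature.Probability.RandomPlanarGeometry.SAW.embMeshVertices emb Ω δ).Finite → Finite (Literature.Probability.RandomPlanarGeometry.SAW.EmbDomainSAW G emb Ω δ a b) := by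
    intro V G emb Ω δ a b hfin
    obtain ⟨S, hS⟩ : ∃ S : Set V, S = insert a (Literature.Probability.RandomPlanarGeometry.SAW.embMeshDomain G emb Ω δ) := ⟨_, rfl⟩
    have hSfin : S.Finite := hS ▸ (hfin.subset (Literature.Probability.RandomPlanarGeometry.SAW.embMeshDomain_subset G emb Ω δ)).insert a
    haveI : Finite S := hSfin.to_subtype
    let ι : Literature.Probability.RandomPlanarGeometry.SAW.EmbDomainSAW G emb Ω δ a b → Literature.Probability.RandomPlanarGeometry.SAW.RestrictedSAW (Literature.Probability.RandomPlanarGeometry.SAW.embDomainGraph G emb Ω δ) S a b :=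
      fun γ => ⟨γ.walk, γ.isPath, fun v hv => by
        rw [hS]
        rcases support_sub G emb Ω δ γ.walk v hv with rfl | h
        · exact Set.mem_insert _ _
        · exact Set.mem_insert_of_mem _ h⟩
    refine Finite.of_injective ι fun γ γ' h => ?_
    have hw : γ.walk = γ'.walk := congrArg Subtype.val h
    cases γ; cases γ'; cases hw; rfl
  -- the hexagonal mesh vertices `δ·hexCenter f ∈ Ω` of a bounded `Ω` are finite (`δ > 0`)
  have finite_hex : ∀ (Ω : Set ℂ), Bornology.IsBounded Ω → ∀ (δ : ℝ), 0 < δ →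
      (Literature.Probability.RandomPlanarGeometry.SAW.embMeshVertices Literature.Probability.LatticeModels.hexCenter Ω δ).Finite := by
    intro Ω hΩ δ hδ
    obtain ⟨M, hM⟩ := hΩ.subset_closedBall 0
    obtain ⟨N, hN⟩ : ∃ N : ℕ, 2 * (M / δ + 2) ≤ N := ⟨_, Nat.le_ceil _⟩
    refine ((Literature.Probability.LatticeModels.box 2 N) ×ˢ (Finset.univ : Finset (Fin 2))).finite_toSet.subset fun f hf => ?_
    rw [Literature.Probability.RandomPlanarGeometry.SAW.mem_embMeshVertices_iff] at hf
    have h1 : ‖(δ : ℂ) * Literature.Probability.LatticeModels.hexCenter f‖ ≤ M := by simpa using hM hf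
    rw [norm_mul, Complex.norm_real, Real.norm_eq_abs, abs_of_pos hδ] at h1
    have h2 : ‖Literature.Probability.LatticeModels.hexCenter f‖ ≤ M / δ := by rwa [le_div_iff₀' hδ]
    have hζ : ‖Literature.Probability.LatticeModels.triZeta‖ = 1 := by
      rw [Complex.norm_eq_sqrt_sq_add_sq, Literature.Probability.LatticeModels.triZeta_re, Literature.Probability.LatticeModels.triZeta_im]
      have h3 : Real.sqrt 3 ^ 2 = 3 := Real.sq_sqrt (by norm_num)
      rw [show (1 / 2 : ℝ) ^ 2 + (Real.sqrt 3 / 2) ^ 2 = 1 by nlinarith [h3]]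
      exact Real.sqrt_one
    have hoff : ‖((f.2 : ℕ) + 1 : ℂ) * (1 + Literature.Probability.LatticeModels.triZeta) / 3‖ ≤ 2 := by
      rw [norm_div, norm_mul]
      have hk : ‖((f.2 : ℕ) + 1 : ℂ)‖ ≤ 2 := by
        rw [show ((f.2 : ℕ) + 1 : ℂ) = (((f.2 : ℕ) + 1 : ℕ) : ℂ) by push_cast; ring, Complex.norm_natCast]
        have := f.2.isLt
        norm_cast
      have h1ζ : ‖(1 : ℂ) + Literature.Probability.LatticeModels.triZeta‖ ≤ 2 := (norm_add_le _ _).trans (by rw [hζ]; norm_num)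
      rw [show ‖(3 : ℂ)‖ = 3 by simp, div_le_iff₀ (by norm_num : (0:ℝ) < 3)]
      calc ‖((f.2 : ℕ) + 1 : ℂ)‖ * ‖(1 : ℂ) + Literature.Probability.LatticeModels.triZeta‖ ≤ 2 * 2 :=
            mul_le_mul hk h1ζ (norm_nonneg _) (by norm_num)
        _ ≤ 2 * 3 := by norm_num
    have h4 : ‖Literature.Probability.LatticeModels.triEmbed f.1‖ ≤ M / δ + 2 := by
      rw [show Literature.Probability.LatticeModels.triEmbed f.1 = Literature.Probability.LatticeModels.hexCenter f - ((f.2 : ℕ) + 1 : ℂ) * (1 + Literature.Probability.LatticeModels.triZeta) / 3 by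
        rw [Literature.Probability.LatticeModels.hexCenter]; ring]
      exact (norm_sub_le _ _).trans (add_le_add h2 hoff)
    have h5 : ∀ i, |(f.1 i : ℝ)| ≤ N := fun i =>
      calc |(f.1 i : ℝ)| ≤ 2 * ‖Literature.Probability.LatticeModels.triEmbed f.1‖ := Literature.Probability.LatticeModels.abs_le_two_mul_norm_triEmbed f.1 i
        _ ≤ 2 * (M / δ + 2) := by gcongr
        _ ≤ N := hN
    simp only [Finset.coe_product, Finset.coe_univ, Set.mem_prod, Finset.mem_coe, Set.mem_univ, and_true]
    rw [Literature.Probability.LatticeModels.mem_box]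
    intro i
    have h6 := h5 i
    rw [abs_le] at h6
    constructor <;> [have := h6.1; have := h6.2] <;> exact_mod_cast this
  intro D a b hab
  obtain ⟨a', b', hab'⟩ := hA D
  let P : ∀ δ : ℝ, Measure (Literature.Probability.RandomPlanarGeometry.SAW.HexDomainSAW D.carrier δ (a' δ) (b' δ)) :=
    fun δ => Literature.Probability.RandomPlanarGeometry.SAW.hexSAWLaw D.carrier δ (a' δ) (b' δ)
  -- the hexagonal laws are eventually probability measures: total weight `> 0` (bypass of a walk) and `< ∞`
  have hprob : ∀ᶠ δ in 𝓝[>] (0 : ℝ), IsProbabilityMeasure (P δ) := by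
    filter_upwards [hab'.reachable, self_mem_nhdsWithin] with δ hr hδ
    haveI : Finite (Literature.Probability.RandomPlanarGeometry.SAW.HexDomainSAW D.carrier δ (a' δ) (b' δ)) :=
      finite_saw _ _ _ _ _ _ (finite_hex D.carrier D.isBounded δ hδ)
    refine Literature.Probability.RandomPlanarGeometry.SAW.isProbabilityMeasure_hexSAWLaw ?_ ?_
    · obtain ⟨p⟩ := hr
      let γ : Literature.Probability.RandomPlanarGeometry.SAW.HexDomainSAW D.carrier δ (a' δ) (b' δ) := ⟨p.bypass, p.bypass_isPath⟩
      have hpos : 0 < Literature.Probability.RandomPlanarGeometry.SAW.hexSAWWeight D.carrier δ (a' δ) (b' δ) {γ} := by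
        rw [Literature.Probability.RandomPlanarGeometry.SAW.hexSAWWeight_singleton]
        exact ENNReal.ofReal_pos.2 (pow_pos Literature.Probability.RandomPlanarGeometry.SAW.hexCriticalFugacity_pos_lt_one.1 _)
      exact (hpos.trans_le (measure_mono (Set.subset_univ _))).ne'
    · letI := Fintype.ofFinite (Literature.Probability.RandomPlanarGeometry.SAW.HexDomainSAW D.carrier δ (a' δ) (b' δ))
      rw [Literature.Probability.RandomPlanarGeometry.SAW.hexSAWWeight, Literature.Probability.RandomPlanarGeometry.SAW.embWeight, Measure.sum_apply _ MeasurableSet.univ, tsum_fintype]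
      refine ENNReal.sum_ne_top.2 fun γ _ => ?_
      simp
  -- probability measures on curve classes, Dirac-padded at the junk meshes, eventually the hexagonal laws
  let c₀ : Literature.Probability.RandomPlanarGeometry.CurveClass ℂ := Literature.Probability.RandomPlanarGeometry.CurveClass.mk (Literature.Probability.RandomPlanarGeometry.Curve.const 0)
  obtain ⟨ν, hνprob, hνeq, hνalt⟩ : ∃ ν : ℝ → Measure (Literature.Probability.RandomPlanarGeometry.CurveClass ℂ), (∀ δ, IsProbabilityMeasure (ν δ)) ∧
      (∀ᶠ δ in 𝓝[>] (0 : ℝ), ν δ = (P δ).map (fun γ => γ.curve)) ∧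
      (∀ δ, ν δ = (P δ).map (fun γ => γ.curve) ∨ ν δ = Measure.dirac c₀) := by
    refine ⟨fun δ => if IsProbabilityMeasure (P δ) then (P δ).map (fun γ => γ.curve) else Measure.dirac c₀,
      fun δ => ?_, ?_, fun δ => ?_⟩
    · by_cases h : IsProbabilityMeasure (P δ)
      · simp only [if_pos h]
        exact Measure.isProbabilityMeasure_map (Literature.Probability.RandomPlanarGeometry.SAW.EmbDomainSAW.measurable_of_top _).aemeasurable
      · simp only [if_neg h]
        infer_instance
    · filter_upwards [hprob] with δ hδ
      simp only [if_pos hδ]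
    · by_cases h : IsProbabilityMeasure (P δ)
      · exact Or.inl (if_pos h)
      · exact Or.inr (if_neg h)
  haveI : ∀ δ, IsProbabilityMeasure (ν δ) := hνprob
  have hint : ∀ f : BoundedContinuousFunction (Literature.Probability.RandomPlanarGeometry.CurveClass ℂ) ℝ, ∀ δ,
      ν δ = (P δ).map (fun γ => γ.curve) → ∫ x, f (id x) ∂ν δ = ∫ γ, f γ.curve ∂(P δ) := by
    intro f δ hδ
    show ∫ x, f x ∂ν δ = _
    rw [hδ, integral_map (Literature.Probability.RandomPlanarGeometry.SAW.EmbDomainSAW.measurable_of_top _).aemeasurable f.continuous.aestronglyMeasurable]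
  -- tightness (HexEventualTight) passes to the padded family
  obtain ⟨δ₀, hδ₀, htight⟩ := hT D a' b' hab'
  have htight' : IsTightMeasureSet ((fun δ => (ν δ).map id) '' Set.Ioc 0 δ₀) := by
    refine (htight.union (isTightMeasureSet_singleton (μ := Measure.dirac c₀))).subset ?_
    rintro _ ⟨δ, hδ, rfl⟩
    simp only [Measure.map_id]
    rcases hνalt δ with h | h
    · exact Or.inl ⟨δ, hδ, h.symm⟩
    · exact Or.inr (by rw [h]; exact Set.mem_singleton _)
  -- Prokhorov + identification of subsequential limits (HexSubseqIdentification) + uniqueness of the SLE law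
  have hconv : Literature.Probability.RandomPlanarGeometry.ConvergesInLawToSLE ((8 : NNReal) / 3) D (Ωδ := fun _ => Literature.Probability.RandomPlanarGeometry.CurveClass ℂ)
      (fun _ => id) ν := by
    refine Literature.Probability.RandomPlanarGeometry.convergesInLawToSLE_of_isTightMeasureSet_image Literature.Probability.RandomPlanarGeometry.IsSLECurve.map_eq_holds
      (Eventually.of_forall fun δ => aemeasurable_id) hδ₀ htight' ?_
    rintro μ hμ ⟨s, hs, hlim⟩
    refine hI D a' b' hab' s μ hs hμ fun f => (hlim f).congr' ?_
    exact (hs.eventually hνeq).mono fun n hn => hint f (s n) hn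
  obtain ⟨Γ, hΓ, -, hTL⟩ := hconv
  -- the hexagonal laws converge to the SLE(8/3) curve Γ; transfer to the square lattice (LatticeUniversality)
  refine ⟨Γ, hΓ, Eventually.of_forall fun δ => Literature.Probability.RandomPlanarGeometry.SAW.aemeasurable_curve _ _ _ _, fun f => ?_⟩
  have h3 := (hU D a b a' b' hab hab' f).add ((hTL f).congr' (hνeq.mono fun δ hδ => hint f δ hδ))
  rw [zero_add] at h3
  exact h3.congr fun δ => sub_add_cancel _ _

end Summit.CriticalPhenomena.SAWScalingLimit.Theses.SAWBetheAnsatz
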